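import Summits.KontsevichZagierPeriods.KontsevichZagierPeriods.Theses.FurushoPentagon
import Summits.KontsevichZagierPeriods.KontsevichZagierPeriods.Theses.LinRedNormalForm
import Summits.KontsevichZagierPeriods.KontsevichZagierPeriods.Theorems.FurushoPentagonKernelModuloPeriodConjectureSplitGlue
import Summits.KontsevichZagierPeriods.KontsevichZagierPeriods.Theorems.FurushoPentagonKernelModuloPeriodConjectureLeafWeightLeSixteen
import Summits.KontsevichZagierPeriods.KontsevichZagierPeriods.Theorems.FurushoPentagonKernelModuloPeriodConjectureLeafOfDual
import Summits.KontsevichZagierPeriods.KontsevichZagierPeriods.Theorems.FurushoPentagonKernelModuloPeriodConjectureLeafLowWeight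
import Summits.KontsevichZagierPeriods.KontsevichZagierPeriods.Theorems.FurushoPentagonKernelModuloPeriodConjectureReplicateEvenLeaf
import Summits.KontsevichZagierPeriods.KontsevichZagierPeriods.Theorems.FurushoPentagonKernelModuloPeriodConjecturePowerFormReplicate
import Summits.KontsevichZagierPeriods.KontsevichZagierPeriods.Theorems.FurushoPentagonKernelModuloPeriodConjectureThreeOneLeaf
import Summits.KontsevichZagierPeriods.KontsevichZagierPeriods.Theorems.FurushoPentagonKernelModuloPeriodConjectureShuffleTwosAlternating
import Literature.NumberTheory.Transcendental.MultipleZetaThreeOneProofs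
import Literature.NumberTheory.Transcendental.MZVDualIndex

/-!
# Crux `KernelModuloPeriodConjecture` (stmt-KontsevichZagierPeriods-15058) — line `genus-zero-funnel`
(planner-cstrat strategist line, 2026-08-17; runs ALONGSIDE the lead's line `Sketch`, which it does not touch)

The crux (route FurushoPentagon, DECLARED REMAINDER): `MzvPeriodConjecture → PentagonInKZ →
ReducedPeriodRing → SectorToKernel`. This line is the BC2-redirect DECOMPOSITION of the crux written as
a skeleton: the crux is the LANDED glue `stub_splitGlue : A → O → crux` (Theorems/…SplitGlue.lean, through
the landed MZV-sector transfer `mzvSectorKernel_of`) applied to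
* the algebraic leaf A = child `AssociatorHoffmanSpanning` — taken here through the SAME two stubs as the
  lead's line `Sketch` v16 (`stub_associatorHoffmanSpanning_of_weight_le_17`, theorem-grade, weight ≤ 16
  already the tree theorem `stub_associatorHoffmanSpanning_of_weight_le_16`; and
  `stub_associatorHoffmanSpanning_residual`, weights ≥ 18 off the landed families — byte-identical
  signatures, so they are SHARED with `Sketch`, not re-staffed), and
* the off-sector complement O = child `OffMzvSectorComplement` — which `Sketch` keeps as ONE opaque stub
  (`stub_offMzvSectorComplement`, "NOT CLAIMED") and which THIS line opens up into a GENUS-ZERO FUNNEL that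
  USES O's hypothesis: R = `LinRedNormalForm.ResidualBeyondGenusZero` (item stmt-3917, by name: every
  vanishing combination is congruent mod relations to a genus-zero combination — the shared declared
  residual of the genus-zero routes, summit-strength off genus zero), N = `LinRedNormalForm.DihedralNormalForm`
  (item stmt-3912, by name: genus-zero reps reduce to MZV word reps; OPEN, staffed; Brown ENS 2009 Thm 1.1
  at rules level), B = the bridge "simplex-sector kernel ⇒ word-sector kernel `LinRedNormalForm.MzvKernelInKZ`
  (item stmt-3914)" (provable now, size M: clear denominators by integrand additivity, calibrate `[Δ_w, ∏ω_ε]`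
  against `KZ.mzvRep`, apply the hypothesis to `N • m`, divide by `N` with the proved `IntegerDivision`).
Composition (`KernelModuloPeriodConjecture_of`, proved): A reassembled from its two stubs and the landed
families exactly as in `Sketch`; O from R, N, B by `c = (c − c₀) + (c₀ − m) + m`; then `stub_splitGlue`.

Why a second line: it types WHERE O's summit-hardness sits (R, shared with LinRedNormalForm / NoriTransfer /
Grothendieck) and what of O is attackable now (B, then N), instead of one unstaffable stub; the continuation
lead may adopt it at a cycle boundary (its A-side is unchanged). STUCK-goal dodge: none needed on A (the
lead's weight-17 programme is progressing); on O the lead's line has no move at all, this one has B.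

Disproof used (`Cruxes/KernelModuloPeriodConjecture/Disproof.lean`): §5 `crux_of_stubs` / landed
`stub_splitGlue` (joint sufficiency, no smuggled gap); `not_stubO_iff` (O unkillable while the sector holds —
so O is funnelled, not attacked); `stubA_false_without_pentagon`, `not_stubAIntegral`,
`not_stubADepthCompatible` (A-stubs keep the pentagon, ℚ-certificates, no depth filtration — inherited
verbatim from `Sketch`); §4: no `_false_without_` theorem exists for Z, P, R — the line uses Z, P, R only
inside the landed transfer. No stub is an instance of a landed Negative lemma.

References: M. Kontsevich, D. Zagier, *Periods* (2001) §1.2; F. Brown, Ann. Sci. ÉNS 42 (2009) Thm 1.1;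
F. Brown, Ann. of Math. 175 (2012) Thm 1.1; H. Furusho, Ann. of Math. 174 (2011) Thm 1.2; V. Drinfeld,
Leningrad Math. J. 2 (1991); K. Ihara, M. Kaneko, D. Zagier, Compos. Math. 142 (2006).
-/

noncomputable section

set_option linter.dupNamespace false

namespace Summit.KontsevichZagierPeriods.KontsevichZagierPeriods.Cruxes.KernelModuloPeriodConjecture.GenusZeroFunnel

open Literature.NumberTheory.Transcendental
open Summit.KontsevichZagierPeriods.KontsevichZagierPeriods.Theses
open Summit.KontsevichZagierPeriods.KontsevichZagierPeriods.Theses.FurushoPentagon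
open Summit.KontsevichZagierPeriods.FurushoPentagon.KernelModuloPeriodConjecture
  (stub_splitGlue stub_associatorHoffmanSpanning_of_weight_le_16 stub_leafOfDual leafLowWeight_of_isHoffman
   stub_replicateEvenLeaf stub_powerFormReplicate stub_threeOneLeaf stub_shuffleTwosAlternating)

/-! ## Registered stubs -/

/-- **A₁₇ — the algebraic leaf in weight `≤ 17`** (SHARED with line `Sketch` v16, same name and signature;
weight `≤ 16` is the tree theorem `stub_associatorHoffmanSpanning_of_weight_le_16`, weight 17 is the lead's
cell-block certificate, landing). [cite: IharaKanekoZagier2006, Conjecture 1] -/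
theorem stub_associatorHoffmanSpanning_of_weight_le_17 :
    ∀ s : List ℕ, MZV.IsAdmissible s → MZV.weight s ≤ 17 →
      ∃ b : List ℕ →₀ ℚ, (∀ t ∈ b.support, MZV.IsHoffman t ∧ MZV.weight t = MZV.weight s) ∧ ∀ (R : Type) [CommRing R] [Algebra ℚ R] [IsReduced R] (φ : NCSeries Bool R), NCSeries.IsGroupLike φ → NCSeries.DrinfeldPentagon φ → φ (MZV.binaryWord s) = b.sum (fun t q => q • φ (MZV.binaryWord t)) := by
  sorry

/-- **A_res — the residual algebraic leaf in weights `≥ 18`** off the landed infinite families and the duals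
of Hoffman words (SHARED with line `Sketch` v16, same name and signature; OPEN: `𝔤𝔯𝔱₁ = 𝔤^𝔪` coordinatewise
in high weight, decidable weight by weight). [cite: Brown2012, Thm 1.1] -/
theorem stub_associatorHoffmanSpanning_residual :
    ∀ s : List ℕ, MZV.IsAdmissible s → 18 ≤ MZV.weight s →
      (∀ c m : ℕ, 1 ≤ c → 1 ≤ m → s ≠ List.replicate m (2 * c)) →
      (∀ n : ℕ, s ≠ (List.replicate n [3, 1]).flatten) →
      (∀ c m : ℕ, 1 ≤ c → 1 ≤ m → MZV.dual s ≠ List.replicate m (2 * c)) →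
      ¬ MZV.IsHoffman (MZV.dual s) →
      ∃ b : List ℕ →₀ ℚ, (∀ t ∈ b.support, MZV.IsHoffman t ∧ MZV.weight t = MZV.weight s) ∧ ∀ (R : Type) [CommRing R] [Algebra ℚ R] [IsReduced R] (φ : NCSeries Bool R), NCSeries.IsGroupLike φ → NCSeries.DrinfeldPentagon φ → φ (MZV.binaryWord s) = b.sum (fun t q => q • φ (MZV.binaryWord t)) := by
  sorry

/-- **R — the genus-zero residual** (= item stmt-KontsevichZagierPeriods-3917
`LinRedNormalForm.ResidualBeyondGenusZero`, by name): every vanishing formal combination is congruent modulo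
`KZ.relations` to a `ℤ`-combination of genus-zero (`M_{0,n}`-cellular) reps. Summit-strength off genus zero —
this is where O's hardness honestly sits. [cite: KontsevichZagier2001, §1.2] -/
theorem stub_residualBeyondGenusZero : LinRedNormalForm.ResidualBeyondGenusZero := by
  sorry

/-- **N — the dihedral normal form** (= item stmt-KontsevichZagierPeriods-3912
`LinRedNormalForm.DihedralNormalForm`, by name): every absolutely convergent genus-zero rep is KZ-equivalent
to a `ℤ`-combination of MZV word reps `[Δ_w, q·∏ω_ε]`. OPEN, staffed. [cite: BrownENS2009, Thm 1.1] -/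
theorem stub_dihedralNormalForm : LinRedNormalForm.DihedralNormalForm := by
  sorry

/-- **B — the bridge** (provable now, size M): the kernel form on the simplex-class sector (O's hypothesis)
implies the kernel form on LinRedNormalForm's word-rep sector (item stmt-KontsevichZagierPeriods-3914
`MzvKernelInKZ`). [cite: KontsevichZagier2001, §1.2] -/
theorem stub_mzvKernelInKZ_of_simplexSectorKernel :
    (∀ c ∈ AddSubgroup.closure (Set.range (fun s : {s : List ℕ // MZV.IsAdmissible s} => KZ.of (KZ.mzvRep s.1 s.2 (KZ.mzvIntegrand_isSemialgebraicFunOn_holds s.1) (KZ.mzvIntegrand_integrableOn_holds s.1 s.2)))), KZ.eval c = 0 → c ∈ KZ.relations) →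
      LinRedNormalForm.MzvKernelInKZ := by
  sorry

/-! ## Glue (proved) — A from its stubs, as in line `Sketch` -/

/-- Packaging: a one-term Hoffman expansion `c_s(φ) = r c_t(φ)` in the leaf's `Finsupp` form. [folklore] -/
theorem leaf_of_single {s t : List ℕ} (ht : MZV.IsHoffman t) (hw : MZV.weight t = MZV.weight s) {r : ℚ}
    (h : ∀ (R : Type) [CommRing R] [Algebra ℚ R] (φ : NCSeries Bool R),
      NCSeries.IsGroupLike φ → NCSeries.DrinfeldPentagon φ →
        φ (MZV.binaryWord s) = r • φ (MZV.binaryWord t)) :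
    ∃ b : List ℕ →₀ ℚ, (∀ t ∈ b.support, MZV.IsHoffman t ∧ MZV.weight t = MZV.weight s) ∧ ∀ (R : Type) [CommRing R] [Algebra ℚ R] [IsReduced R] (φ : NCSeries Bool R), NCSeries.IsGroupLike φ → NCSeries.DrinfeldPentagon φ → φ (MZV.binaryWord s) = b.sum (fun t q => q • φ (MZV.binaryWord t)) := by
  refine ⟨Finsupp.single t r, fun u hu => ?_, fun R _ _ _ φ hg h5 => ?_⟩
  · have hut : u = t := by
      by_contra hne
      exact (Finsupp.mem_support_iff.mp hu) (Finsupp.single_eq_of_ne hne)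
    subst hut
    exact ⟨ht, hw⟩
  · rw [h R φ hg h5]
    exact (Finsupp.sum_single_index (h := fun t q => q • φ (MZV.binaryWord t)) (zero_smul ℚ _)).symm

/-- `{2}ᵏ` is a Hoffman index of weight `2k`. [folklore] -/
theorem isHoffman_twos_and_weight (k : ℕ) :
    MZV.IsHoffman (List.replicate k 2) ∧ MZV.weight (List.replicate k 2) = 2 * k :=
  ⟨fun i hi => Or.inl (List.eq_of_mem_replicate hi), by simp [MZV.weight, List.sum_replicate]; ring⟩

/-- The repeated-even-letter family `{2c}ᵐ`, leaf form (Euler for associators at `m = 1`).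
[cite: Hoffman1992, Theorem 2.2] -/
theorem leaf_replicateEven (c m : ℕ) (hc : 1 ≤ c) (hm : 1 ≤ m) :
    ∃ b : List ℕ →₀ ℚ, (∀ t ∈ b.support, MZV.IsHoffman t ∧ MZV.weight t = MZV.weight (List.replicate m (2 * c))) ∧ ∀ (R : Type) [CommRing R] [Algebra ℚ R] [IsReduced R] (φ : NCSeries Bool R), NCSeries.IsGroupLike φ → NCSeries.DrinfeldPentagon φ → φ (MZV.binaryWord (List.replicate m (2 * c))) = b.sum (fun t q => q • φ (MZV.binaryWord t)) := by
  obtain ⟨r, hr⟩ := stub_replicateEvenLeaf stub_powerFormReplicate c m hc hm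
  exact leaf_of_single (isHoffman_twos_and_weight (c * m)).1
    (by rw [(isHoffman_twos_and_weight (c * m)).2]; simp [MZV.weight, List.sum_replicate]; ring) hr

/-- The Zagier–Broadhurst family `{3,1}ⁿ`, leaf form. [cite: BBBL1998, §6 Theorem 1] -/
theorem leaf_threeOne (n : ℕ) :
    ∃ b : List ℕ →₀ ℚ, (∀ t ∈ b.support, MZV.IsHoffman t ∧ MZV.weight t = MZV.weight (List.replicate n [3, 1]).flatten) ∧ ∀ (R : Type) [CommRing R] [Algebra ℚ R] [IsReduced R] (φ : NCSeries Bool R), NCSeries.IsGroupLike φ → NCSeries.DrinfeldPentagon φ → φ (MZV.binaryWord (List.replicate n [3, 1]).flatten) = b.sum (fun t q => q • φ (MZV.binaryWord t)) := by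
  obtain ⟨r, hr⟩ := stub_threeOneLeaf stub_shuffleTwosAlternating stub_powerFormReplicate n
  exact leaf_of_single (isHoffman_twos_and_weight (2 * n)).1
    (by rw [(isHoffman_twos_and_weight (2 * n)).2, weight_threeOne]; ring) hr

/-- **The algebraic leaf, all weights, from the two A-stubs** (weight `≤ 17` stub, the landed families
`{2c}ᵐ`, `{3,1}ⁿ`, their duals and the duals of Hoffman words, the residual stub). [folklore] -/
theorem associatorHoffmanSpanning_of_stubs
    (h17 : ∀ s : List ℕ, MZV.IsAdmissible s → MZV.weight s ≤ 17 →
      ∃ b : List ℕ →₀ ℚ, (∀ t ∈ b.support, MZV.IsHoffman t ∧ MZV.weight t = MZV.weight s) ∧ ∀ (R : Type) [CommRing R] [Algebra ℚ R] [IsReduced R] (φ : NCSeries Bool R), NCSeries.IsGroupLike φ → NCSeries.DrinfeldPentagon φ → φ (MZV.binaryWord s) = b.sum (fun t q => q • φ (MZV.binaryWord t)))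
    (hres : ∀ s : List ℕ, MZV.IsAdmissible s → 18 ≤ MZV.weight s →
      (∀ c m : ℕ, 1 ≤ c → 1 ≤ m → s ≠ List.replicate m (2 * c)) →
      (∀ n : ℕ, s ≠ (List.replicate n [3, 1]).flatten) →
      (∀ c m : ℕ, 1 ≤ c → 1 ≤ m → MZV.dual s ≠ List.replicate m (2 * c)) →
      ¬ MZV.IsHoffman (MZV.dual s) →
      ∃ b : List ℕ →₀ ℚ, (∀ t ∈ b.support, MZV.IsHoffman t ∧ MZV.weight t = MZV.weight s) ∧ ∀ (R : Type) [CommRing R] [Algebra ℚ R] [IsReduced R] (φ : NCSeries Bool R), NCSeries.IsGroupLike φ → NCSeries.DrinfeldPentagon φ → φ (MZV.binaryWord s) = b.sum (fun t q => q • φ (MZV.binaryWord t))) :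
    ∀ s : List ℕ, MZV.IsAdmissible s → ∃ b : List ℕ →₀ ℚ, (∀ t ∈ b.support, MZV.IsHoffman t ∧ MZV.weight t = MZV.weight s) ∧ ∀ (R : Type) [CommRing R] [Algebra ℚ R] [IsReduced R] (φ : NCSeries Bool R), NCSeries.IsGroupLike φ → NCSeries.DrinfeldPentagon φ → φ (MZV.binaryWord s) = b.sum (fun t q => q • φ (MZV.binaryWord t)) := by
  intro s hs
  by_cases hle : MZV.weight s ≤ 17
  · exact h17 s hs hle
  by_cases hr : ∃ c m : ℕ, 1 ≤ c ∧ 1 ≤ m ∧ s = List.replicate m (2 * c)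
  · obtain ⟨c, m, hc, hm, rfl⟩ := hr
    exact leaf_replicateEven c m hc hm
  by_cases ht : ∃ n : ℕ, s = (List.replicate n [3, 1]).flatten
  · obtain ⟨n, rfl⟩ := ht
    exact leaf_threeOne n
  by_cases hd : ∃ c m : ℕ, 1 ≤ c ∧ 1 ≤ m ∧ MZV.dual s = List.replicate m (2 * c)
  · obtain ⟨c, m, hc, hm, hcm⟩ := hd
    exact stub_leafOfDual s hs (hcm ▸ leaf_replicateEven c m hc hm)
  by_cases hh : MZV.IsHoffman (MZV.dual s)
  · exact stub_leafOfDual s hs (leafLowWeight_of_isHoffman hh)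
  push Not at hr ht hd
  exact hres s hs (by omega) (fun c m hc hm => hr c m hc hm) ht (fun c m hc hm => hd c m hc hm) hh

/-! ## Glue (proved) — O through the genus-zero funnel -/

/-- Additive extension of a generatorwise congruence over an `AddSubgroup.closure` (as in
`LinRedNormalForm.closes`). [folklore] -/
theorem closure_congr_extend {S T : Set KZ.FormalRep} (c : KZ.FormalRep) (hc : c ∈ AddSubgroup.closure S)
    (hS : ∀ x ∈ S, ∃ m ∈ AddSubgroup.closure T, x - m ∈ KZ.relations) :
    ∃ m ∈ AddSubgroup.closure T, c - m ∈ KZ.relations := by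
  induction hc using AddSubgroup.closure_induction with
  | mem x hx => exact hS x hx
  | zero => exact ⟨0, zero_mem _, by simp⟩
  | add x y _ _ ihx ihy =>
    obtain ⟨m₁, hm₁, h₁⟩ := ihx
    obtain ⟨m₂, hm₂, h₂⟩ := ihy
    refine ⟨m₁ + m₂, add_mem hm₁ hm₂, ?_⟩
    have key := add_mem h₁ h₂
    rwa [show x - m₁ + (y - m₂) = x + y - (m₁ + m₂) by abel] at key
  | neg x _ ih =>
    obtain ⟨m, hm, h⟩ := ih
    refine ⟨-m, neg_mem hm, ?_⟩
    have key := neg_mem h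
    rwa [show -(x - m) = -x - -m by abel] at key

/-- **The off-sector complement O from R, N, B**: given the simplex-sector kernel and `eval c = 0`, R gives
`c ≡ c₀` (genus zero), N extended additively gives `c₀ ≡ m` (MZV words), soundness gives `eval m = 0`, B gives
`m ∈ relations`, and `c = (c − c₀) + (c₀ − m) + m`. [cite: KontsevichZagier2001, §1.2] -/
theorem offMzvSectorComplement_of_funnel
    (hRES : LinRedNormalForm.ResidualBeyondGenusZero) (hDNF : LinRedNormalForm.DihedralNormalForm)
    (hBR : (∀ c ∈ AddSubgroup.closure (Set.range (fun s : {s : List ℕ // MZV.IsAdmissible s} => KZ.of (KZ.mzvRep s.1 s.2 (KZ.mzvIntegrand_isSemialgebraicFunOn_holds s.1) (KZ.mzvIntegrand_integrableOn_holds s.1 s.2)))), KZ.eval c = 0 → c ∈ KZ.relations) →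
      LinRedNormalForm.MzvKernelInKZ) :
    (∀ c ∈ AddSubgroup.closure (Set.range (fun s : {s : List ℕ // MZV.IsAdmissible s} => KZ.of (KZ.mzvRep s.1 s.2 (KZ.mzvIntegrand_isSemialgebraicFunOn_holds s.1) (KZ.mzvIntegrand_integrableOn_holds s.1 s.2)))), KZ.eval c = 0 → c ∈ KZ.relations) → ∀ c : KZ.FormalRep, KZ.eval c = 0 → c ∈ KZ.relations := by
  intro hM c hc
  have hsound : ∀ x ∈ KZ.relations, KZ.eval x = 0 := fun x hx =>
    (AddMonoidHom.mem_ker).1 (KZ.relations_le_ker_eval_holds hx)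
  obtain ⟨c₀, hc₀, h₁⟩ := hRES c hc
  obtain ⟨m, hm, h₂⟩ := closure_congr_extend c₀ hc₀ (fun x hx => by
    obtain ⟨k, r, p, a, b, c', hd, hi, rfl⟩ := hx
    exact hDNF k r p a b c' hd hi)
  have hm0 : KZ.eval m = 0 := by
    have e1 := hsound _ h₁
    have e2 := hsound _ h₂
    rw [map_sub] at e1 e2
    linarith
  have hmrel : m ∈ KZ.relations := hBR hM m hm hm0
  have hsplit : c = (c - c₀) + (c₀ - m) + m := by abel
  rw [hsplit]
  exact add_mem (add_mem h₁ h₂) hmrel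

/-! ## The crux from the stubs, by name -/

/-- **`KernelModuloPeriodConjecture` from the registered stubs, by name** — A from (A₁₇, A_res), O from
(R, N, B), then the LANDED split glue `stub_splitGlue : A → O → crux` (which feeds `MzvPeriodConjecture`,
`PentagonInKZ`, `ReducedPeriodRing` to the landed transfer `mzvSectorKernel_of`). [folklore] -/
theorem KernelModuloPeriodConjecture_of : KernelModuloPeriodConjecture :=
  stub_splitGlue
    (associatorHoffmanSpanning_of_stubs stub_associatorHoffmanSpanning_of_weight_le_17
      stub_associatorHoffmanSpanning_residual)
    (offMzvSectorComplement_of_funnel stub_residualBeyondGenusZero stub_dihedralNormalForm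
      stub_mzvKernelInKZ_of_simplexSectorKernel)

end Summit.KontsevichZagierPeriods.KontsevichZagierPeriods.Cruxes.KernelModuloPeriodConjecture.GenusZeroFunnel

end
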